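import Summits.QuantumAdvantage.AdviceFreeQNC0.CodegThreeSyndrome
import Summits.QuantumAdvantage.AdviceFreeQNC0.DegreeBridge
import Literature.Computability.MetaComplexity.LowDegFlatIndicator
import Summits.QuantumAdvantage.QuantumAdvantage.Theorems.CubicForrelationNearExactIsExactInvariantWeight
import HarnessLib

/-!
# Cell qa-qnc0 (rung F-S1, route RingFrame, crux α, line `tensor`): R1U at co-degree three, part 2a —
# linear point sets of `{0,1}^m` as subspaces of `𝔽₂^m`, and the top-layer LEADERS ARE 3-FLATS

Infrastructure for the top layer of planner qa-qnc0-p2's ROUND-5 THEOREM E3 (`CodegThreeTop.lean`,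
`CodegThree.lean`):

* `CodegThree.LinSet` — a LINEAR point set (`0 ∈ V₀`, `⊕`-closed; bundled) and `LinSet.toSub`, the subspace of
  `𝔽₂^m` it spans (= its image under `bvec`); `|pts| = 2^{dim}` (`card_eq_two_pow_finrank`), order = inclusion,
  `toSub (A ∩ B) = toSub A ⊓ toSub B`, LAGRANGE (`pts_eq_of_lt_two_mul_card`: a linear subset with more than half
  the points is everything) and the HALF-FLAT LEMMA (`subset_of_lt_two_mul_card_inter`: a flat `z ⊕ G₀` holding
  more than half of the points of a linear set `A` contains `A` and is linear).
* `CodegThree.exists_linSet_rep` — **LEADERS ARE 3-FLATS, LINEARLY REPRESENTED**: on `m = d+4` bits a non-zero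
  order-`≤ 3` syndrome `syn3 𝟙_a`, `|a| ≤ 8`, with vanishing coordinates of order `≤ 2`, is `syn3 𝟙_{V₀}` for a
  LINEAR point set `V₀` of size `8`: `𝟙_a ⊥ RM(2,m)` gives `𝟙_a ∈ RM(m−3, m)` (duality), of weight `≤ 8 = d_min`,
  so `a = x₀ ⊕ V₀` is a 3-flat (Kasami–Tokura gap + MacWilliams–Sloane Ch.13 Thm 8 through
  `support_flat_of_lt_three_halves`), and `𝟙_a + 𝟙_{V₀}` is `0` or the indicator of the 4-space `V₀ ⊕ ⟨x₀⟩`, which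
  lies in `RM(m−4, m) = ker syn3` (MacWilliams–Sloane Ch.13 Thm 7 = `Smolensky.indicator_coset_mem_lowDeg`).

The cell's lemmas (planner qa-qnc0-p2 gen 5 ROUND-5 §2.3; seat qa-qnc0-lit gen 11, 2026-08-27).  WHAT THIS IS
NOT: nothing on co-degree `≥ 4`, `LiftOneU`, α or the separation.
-/

noncomputable section

namespace Summit.QuantumAdvantage.AdviceFreeQNC0

open Finset Module
open Literature.Computability.MetaComplexity Literature.Computability.MetaComplexity.Smolensky
open Literature.Computability.QuantumComplexity.BuzetChailloux (bxor zeroVec bxor_comm bxor_self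
  bxor_bxor_cancel_left bxor_zeroVec)
open Syndrome2 Syndrome3
open Summit.QuantumAdvantage.QuantumAdvantage.Theorems.CubicForrelation.NearExactIsExact (iw_bxor_assoc
  iw_bxor_injective)

namespace CodegThree

variable {n : ℕ}

/-! ### Bit-vector algebra -/

/-- `⊕` left-commutes. -/
theorem bxor_left_comm (x y z : Fin n → Bool) : bxor x (bxor y z) = bxor y (bxor x z) := by
  rw [← iw_bxor_assoc, bxor_comm x y, iw_bxor_assoc]

/-- `bvec (x ⊕ y) = bvec x + bvec y`. -/
theorem bvec_bxor (x y : Fin n → Bool) : bvec (bxor x y) = bvec x + bvec y := by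
  funext i
  show (if (xor (x i) (y i)) = true then (1 : ZMod 2) else 0) = _
  rw [MeanLoad.ind_xor]
  rfl

/-- `bvec 0 = 0`. -/
theorem bvec_zeroVec : bvec (zeroVec : Fin n → Bool) = 0 := by
  funext i; rfl

/-- `𝟙_a` through `decide`: the `HasDeg`-indicator of `u ↦ decide (u ∈ a)` is `indF a`. -/
theorem ind_decide_mem (a : Finset (Fin n → Bool)) :
    (fun u => if decide (u ∈ a) = true then (1 : ZMod 2) else 0) = indF a := by
  funext u; unfold indF; simp only [decide_eq_true_eq]

/-- The support of `u ↦ decide (u ∈ a)` is `a`. -/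
theorem filter_decide_mem (a : Finset (Fin n → Bool)) :
    (univ.filter fun u => decide (u ∈ a) = true) = a := by
  ext u; simp

/-! ### Linear point sets (`0 ∈ V₀`, `⊕`-closed) as subspaces of `𝔽₂^n` -/

/-- A LINEAR point set of `{0,1}^n`: contains `0`, closed under `⊕` (a subgroup; bundled). -/
structure LinSet (n : ℕ) where
  /-- the points -/
  pts : Finset (Fin n → Bool)
  /-- `0 ∈ pts` -/
  zero_mem : zeroVec ∈ pts
  /-- closed under `⊕` -/
  xor_mem : ∀ a ∈ pts, ∀ b ∈ pts, bxor a b ∈ pts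

namespace LinSet

/-- Two linear sets with the same points are equal. -/
theorem ext' {A B : LinSet n} (h : A.pts = B.pts) : A = B := by
  cases A; cases B; cases h; rfl

/-- Intersection of linear sets. -/
def inter (A B : LinSet n) : LinSet n :=
  ⟨A.pts ∩ B.pts, Finset.mem_inter.2 ⟨A.zero_mem, B.zero_mem⟩, fun a ha b hb =>
    Finset.mem_inter.2 ⟨A.xor_mem a (Finset.mem_inter.1 ha).1 b (Finset.mem_inter.1 hb).1,
      B.xor_mem a (Finset.mem_inter.1 ha).2 b (Finset.mem_inter.1 hb).2⟩⟩

/-- Unfolding lemma. -/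
@[simp] theorem inter_pts (A B : LinSet n) : (A.inter B).pts = A.pts ∩ B.pts := rfl

/-- **A linear point set as a subspace of `𝔽₂^n`** (its image under `bvec`). -/
def toSub (A : LinSet n) : Submodule (ZMod 2) (Fin n → ZMod 2) where
  carrier := bvec '' (A.pts : Set (Fin n → Bool))
  add_mem' := by
    rintro _ _ ⟨a, ha, rfl⟩ ⟨b, hb, rfl⟩
    exact ⟨bxor a b, A.xor_mem a ha b hb, bvec_bxor a b⟩
  zero_mem' := ⟨zeroVec, A.zero_mem, bvec_zeroVec⟩
  smul_mem' := by
    rintro c _ ⟨a, ha, rfl⟩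
    have hc : c = 0 ∨ c = 1 := by revert c; decide
    rcases hc with rfl | rfl
    · rw [zero_smul]; exact ⟨zeroVec, A.zero_mem, bvec_zeroVec⟩
    · rw [one_smul]; exact ⟨a, ha, rfl⟩

/-- Membership in `toSub`. -/
theorem bvec_mem_toSub (A : LinSet n) {v : Fin n → Bool} : bvec v ∈ A.toSub ↔ v ∈ A.pts := by
  constructor
  · rintro ⟨a, ha, hav⟩
    rw [← bvec_injective hav]
    exact ha
  · intro hv
    exact ⟨v, hv, rfl⟩

/-- Every element of `toSub` is a `bvec` of a point. -/
theorem exists_of_mem_toSub (A : LinSet n) {x : Fin n → ZMod 2} (hx : x ∈ A.toSub) :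
    ∃ v ∈ A.pts, bvec v = x := hx

/-- **`|pts| = 2^{dim}`.** -/
theorem card_eq_two_pow_finrank (A : LinSet n) : A.pts.card = 2 ^ finrank (ZMod 2) A.toSub := by
  have hcard : Nat.card A.toSub = A.pts.card := by
    show Nat.card ↥(bvec '' (A.pts : Set (Fin n → Bool))) = A.pts.card
    rw [Nat.card_image_of_injective bvec_injective, Nat.card_coe_set_eq, Set.ncard_coe_finset]
  have h2 : Nat.card (ZMod 2) = 2 := by rw [Nat.card_eq_fintype_card, ZMod.card]
  rw [← hcard, Module.natCard_eq_pow_finrank (K := ZMod 2) (V := A.toSub), h2]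

/-- `|pts| = 2^k` determines the dimension. -/
theorem finrank_eq_of_card {A : LinSet n} {k : ℕ} (h : A.pts.card = 2 ^ k) : finrank (ZMod 2) A.toSub = k := by
  have := A.card_eq_two_pow_finrank
  rw [h] at this
  exact (Nat.pow_right_injective (le_refl 2) this).symm

/-- Order on `toSub` is inclusion of point sets. -/
theorem toSub_le_iff (A B : LinSet n) : A.toSub ≤ B.toSub ↔ A.pts ⊆ B.pts := by
  constructor
  · intro h v hv
    exact B.bvec_mem_toSub.1 (h (A.bvec_mem_toSub.2 hv))
  · rintro h _ ⟨a, ha, rfl⟩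
    exact ⟨a, h ha, rfl⟩

/-- `toSub` is injective on point sets. -/
theorem pts_eq_of_toSub_eq {A B : LinSet n} (h : A.toSub = B.toSub) : A.pts = B.pts :=
  Finset.Subset.antisymm ((toSub_le_iff A B).1 h.le) ((toSub_le_iff B A).1 h.ge)

/-- `toSub (A ∩ B) = toSub A ⊓ toSub B`. -/
theorem toSub_inter (A B : LinSet n) : (A.inter B).toSub = A.toSub ⊓ B.toSub := by
  ext x
  constructor
  · rintro ⟨a, ha, rfl⟩
    rw [Finset.mem_coe, inter_pts, Finset.mem_inter] at ha
    exact Submodule.mem_inf.2 ⟨A.bvec_mem_toSub.2 ha.1, B.bvec_mem_toSub.2 ha.2⟩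
  · intro hx
    obtain ⟨a, ha, rfl⟩ := A.exists_of_mem_toSub (Submodule.mem_inf.1 hx).1
    have hb : a ∈ B.pts := B.bvec_mem_toSub.1 (Submodule.mem_inf.1 hx).2
    exact ⟨a, Finset.mem_coe.2 (Finset.mem_inter.2 ⟨ha, hb⟩), rfl⟩

/-- **Lagrange**: a linear subset holding more than half of the points of a linear set is all of it. -/
theorem pts_eq_of_lt_two_mul_card (H A : LinSet n) (hHA : H.pts ⊆ A.pts) (hbig : A.pts.card < 2 * H.pts.card) :
    H.pts = A.pts := by
  have hle : H.toSub ≤ A.toSub := (toSub_le_iff H A).2 hHA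
  have hH2 := H.card_eq_two_pow_finrank
  have hA2 := A.card_eq_two_pow_finrank
  have hfin : finrank (ZMod 2) H.toSub ≤ finrank (ZMod 2) A.toSub := Submodule.finrank_mono hle
  have heq : finrank (ZMod 2) H.toSub = finrank (ZMod 2) A.toSub := by
    by_contra hne
    have hlt : finrank (ZMod 2) H.toSub + 1 ≤ finrank (ZMod 2) A.toSub := by omega
    have := Nat.pow_le_pow_right (show 0 < 2 by norm_num) hlt
    rw [pow_succ] at this
    omega
  exact pts_eq_of_toSub_eq (Submodule.eq_of_le_of_finrank_eq hle heq)

/-- Translating a linear set by one of its points gives the set back. -/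
theorem image_bxor_eq_self (A : LinSet n) {z : Fin n → Bool} (hz : z ∈ A.pts) : A.pts.image (bxor z) = A.pts := by
  apply Finset.eq_of_subset_of_card_le
  · intro y hy
    obtain ⟨g, hg, rfl⟩ := Finset.mem_image.1 hy
    exact A.xor_mem z hz g hg
  · rw [Finset.card_image_of_injective _ (iw_bxor_injective z)]

/-- **Half-flat lemma**: if a flat `S = z ⊕ G₀` (`G₀` linear, for every `z ∈ S`) holds MORE THAN HALF of the
points of a linear set `A`, then `A ⊆ S` and `S = G₀` is linear. -/
theorem subset_of_lt_two_mul_card_inter (A G₀ : LinSet n) {S : Finset (Fin n → Bool)}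
    (hS : ∀ z ∈ S, S = G₀.pts.image (bxor z)) (hbig : A.pts.card < 2 * (A.pts ∩ S).card) :
    A.pts ⊆ S ∧ S = G₀.pts := by
  have hne : (A.pts ∩ S).Nonempty := by rw [← Finset.card_pos]; omega
  obtain ⟨z, hz⟩ := hne
  rw [Finset.mem_inter] at hz
  have hSz := hS z hz.2
  -- `y ↦ z ⊕ y` maps `A ∩ S` into `A ∩ G₀`
  have hmap : ∀ y ∈ A.pts ∩ S, bxor z y ∈ (A.inter G₀).pts := by
    intro y hy
    rw [Finset.mem_inter] at hy
    rw [inter_pts, Finset.mem_inter]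
    refine ⟨A.xor_mem z hz.1 y hy.1, ?_⟩
    have hy2 := hy.2
    rw [hSz, Finset.mem_image] at hy2
    obtain ⟨g, hg, rfl⟩ := hy2
    rw [bxor_bxor_cancel_left]
    exact hg
  have hcard : (A.pts ∩ S).card ≤ (A.inter G₀).pts.card :=
    Finset.card_le_card_of_injOn (bxor z) hmap ((iw_bxor_injective z).injOn)
  -- so `A ∩ G₀` is a linear subset of `A` with more than half its points: `A ⊆ G₀`
  have hAG : (A.inter G₀).pts = A.pts :=
    pts_eq_of_lt_two_mul_card (A.inter G₀) A Finset.inter_subset_left (by omega)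
  have hAsub : A.pts ⊆ G₀.pts := by
    intro a ha
    rw [← hAG, inter_pts, Finset.mem_inter] at ha
    exact ha.2
  have hSG : S = G₀.pts := by rw [hSz]; exact G₀.image_bxor_eq_self (hAsub hz.1)
  exact ⟨hSG ▸ hAsub, hSG⟩

end LinSet

open LinSet

/-! ### Leaders of the top layer are 3-flats with a linear representative -/

variable {d : ℕ}

/-- `2^(d+4)`-arithmetic. -/
theorem pow_d4 (d : ℕ) : 2 ^ (d + 4) = 2 ^ d * 16 := by ring

/-- **LEADERS ARE 3-FLATS, LINEARLY REPRESENTED**: on `m = d+4` bits, a non-zero order-`≤ 3` syndrome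
`s = syn3 𝟙_a` with `|a| ≤ 8` and vanishing coordinates of order `≤ 2` is the syndrome of a LINEAR point set
of size `8` (a `3`-dimensional subspace of `𝔽₂^m`). [cite: MacWilliamsSloane1977, Ch. 13 §4 Thms 7–8] -/
theorem exists_linSet_rep {s : Finset (Fin (d + 4)) → ZMod 2} (hs : s ≠ 0) {a : Finset (Fin (d + 4) → Bool)}
    (ha8 : a.card ≤ 8) (has : syn3 (indF a) = s) (hlow : ∀ J : Finset (Fin (d + 4)), J.card ≤ 2 → s J = 0) :
    ∃ V : LinSet (d + 4), V.pts.card = 8 ∧ syn3 (indF V.pts) = s := by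
  classical
  -- `a ≠ ∅`, `𝟙_a ∈ RM(d+1, d+4)`
  have hne : ∃ x, decide (x ∈ a) = true := by
    by_contra h
    push Not at h
    apply hs
    rw [← has]
    have : indF a = 0 := by
      funext v; unfold indF
      rw [if_neg (by simpa using h v)]; rfl
    rw [this, map_zero]
  have hdeg : HasDeg (fun u => decide (u ∈ a)) (d + 1) := by
    show (fun u => if decide (u ∈ a) = true then (1 : ZMod 2) else 0) ∈ lowDeg (ZMod 2) (d + 4) (d + 1)
    rw [ind_decide_mem]
    have h := indF_mem_lowDeg_of_low_eq_zero (m := d + 4) (by omega) a fun J hJ => by rw [has]; exact hlow J hJ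
    rwa [show d + 4 - 3 = d + 1 by omega] at h
  have hlt : 2 ^ (d + 1 + 1) * #(univ.filter fun x => decide (x ∈ a) = true) < 3 * 2 ^ (d + 4) := by
    rw [filter_decide_mem]
    have h1 : 2 ^ (d + 1 + 1) * a.card ≤ 2 ^ (d + 1 + 1) * 8 := Nat.mul_le_mul_left _ ha8
    have h2 : 2 ^ (d + 4) = 2 ^ (d + 1 + 1) * 4 := by ring
    have hpos := Nat.two_pow_pos (d + 1 + 1)
    omega
  obtain ⟨hw, h0, hadd, hcard, hcoset⟩ :=
    support_flat_of_lt_three_halves (m := d + 4) (Nat.succ_pos d) _ hdeg hne hlt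
  rw [filter_decide_mem] at hw hcard hcoset
  have ha : a.card = 8 := by
    rw [show 2 ^ (d + 4) = 2 ^ (d + 1) * 8 by ring] at hw
    exact Nat.eq_of_mul_eq_mul_left (Nat.two_pow_pos _) hw
  -- the period group `G`
  set Per := (univ.filter fun t : Fin (d + 4) → Bool => ∀ x, decide (bxor x t ∈ a) = decide (x ∈ a)) with hPer
  let G : LinSet (d + 4) := ⟨Per, h0, hadd⟩
  have hG8 : G.pts.card = 8 := hcard.trans ha
  obtain ⟨x₀, hx₀⟩ := hne
  have hax : a = Per.image (bxor x₀) := hcoset x₀ hx₀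
  refine ⟨G, hG8, ?_⟩
  -- `𝟙_a - 𝟙_G ∈ ker syn3 = RM(d, d+4)`
  rw [← has, ← sub_eq_zero, ← map_sub, ← LinearMap.mem_ker, ker_syn3_eq_lowDeg, CharTwo.sub_eq_add]
  by_cases hxP : x₀ ∈ Per
  · -- `a = G`
    have haG : a = Per := by rw [hax]; exact G.image_bxor_eq_self hxP
    rw [haG, CharTwo.add_self_eq_zero]
    exact Submodule.zero_mem _
  · -- `a ⊔ G` is a linear set of size 16, whose indicator is in `RM(d, d+4)`
    have hdisj : Disjoint Per (Per.image (bxor x₀)) := by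
      rw [Finset.disjoint_left]
      intro g hg hgi
      obtain ⟨g', hg', rfl⟩ := Finset.mem_image.1 hgi
      apply hxP
      have : x₀ = bxor (bxor x₀ g') g' := by rw [iw_bxor_assoc, bxor_self, bxor_zeroVec]
      rw [this]
      exact hadd _ hg _ hg'
    let V₁ : LinSet (d + 4) := ⟨Per ∪ Per.image (bxor x₀), Finset.mem_union_left _ h0, by
      intro p hp q hq
      rw [Finset.mem_union] at hp hq ⊢
      rcases hp with hp | hp <;> rcases hq with hq | hq
      · exact Or.inl (hadd p hp q hq)
      · obtain ⟨g, hg, rfl⟩ := Finset.mem_image.1 hq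
        rw [bxor_left_comm]
        exact Or.inr (Finset.mem_image.2 ⟨bxor p g, hadd p hp g hg, rfl⟩)
      · obtain ⟨g, hg, rfl⟩ := Finset.mem_image.1 hp
        rw [iw_bxor_assoc]
        exact Or.inr (Finset.mem_image.2 ⟨bxor g q, hadd g hg q hq, rfl⟩)
      · obtain ⟨g, hg, rfl⟩ := Finset.mem_image.1 hp
        obtain ⟨g', hg', rfl⟩ := Finset.mem_image.1 hq
        rw [iw_bxor_assoc, bxor_left_comm g, bxor_bxor_cancel_left]
        exact Or.inl (hadd g hg g' hg')⟩
    have hV16 : V₁.pts.card = 2 ^ 4 := by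
      show (Per ∪ Per.image (bxor x₀)).card = 16
      rw [Finset.card_union_of_disjoint hdisj, Finset.card_image_of_injective _ (iw_bxor_injective x₀)]
      show Per.card + Per.card = 16
      rw [hG8]
    have hfin : finrank (ZMod 2) V₁.toSub = 4 := finrank_eq_of_card hV16
    have hmem := indicator_coset_mem_lowDeg (n := d + 4) 0 d V₁.toSub (by rw [hfin]; omega)
    have hfun : (fun u : Fin (d + 4) → Bool =>
        if (fun i => if u i then (1 : ZMod 2) else 0) - 0 ∈ V₁.toSub then (1 : ZMod 2) else 0) = indF V₁.pts := by
      funext u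
      rw [sub_zero]
      change (if bvec u ∈ V₁.toSub then (1 : ZMod 2) else 0) = indF V₁.pts u
      unfold indF
      by_cases hu : u ∈ V₁.pts
      · rw [if_pos hu, if_pos (V₁.bvec_mem_toSub.2 hu)]
      · rw [if_neg hu, if_neg (fun h => hu (V₁.bvec_mem_toSub.1 h))]
    rw [hfun] at hmem
    have hsum : indF Per + indF a = indF V₁.pts := by
      funext u
      have hmem' : u ∈ V₁.pts ↔ u ∈ Per ∨ u ∈ a := by
        show u ∈ Per ∪ Per.image (bxor x₀) ↔ _
        rw [Finset.mem_union, ← hax]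
      show (if u ∈ Per then (1 : ZMod 2) else 0) + (if u ∈ a then 1 else 0) = if u ∈ V₁.pts then 1 else 0
      by_cases h1 : u ∈ Per <;> by_cases h2 : u ∈ a
      · have h2' : u ∈ Per.image (bxor x₀) := hax ▸ h2
        exact absurd (Finset.disjoint_left.1 hdisj h1) (not_not.2 h2')
      · simp [h1, h2, hmem']
      · simp [h1, h2, hmem']
      · simp [h1, h2, hmem']
    rw [show indF G.pts + indF a = indF V₁.pts from hsum]
    exact hmem

end CodegThree

end Summit.QuantumAdvantage.AdviceFreeQNC0

end
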